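import Literature.RepresentationTheory.BorelWallach2000.TrivialModuleGKCohomologyUnitary  -- ★ blocks of `𝔲(α,β)`, `K`, `kV`, `cochain_apply_eq_of_forall_sub_mem`
import Literature.RepresentationTheory.BorelWallach2000.UpqHodgeBigrading               -- ★ `upqTypeClasses` (`H^n_δ(𝔲(α,β), K; V)`)
import Literature.NumberTheory.Automorphic.AutomorphicCharacterLine                      -- ★ `DiscreteAutomorphicRep.ofChar`, `isOneDimensional_ofChar`
import Summits.HodgeConjecture.HodgeConjecture.Theorems.F0P3SLayerFoldShapes             -- ★ «Tok» producer `exists_cohToken_of_isHolOrAntihol_cpt`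
import HarnessLib

/-!
# (N1) «NOT-A-CHARACTER»: a discrete automorphic `P` of `U(H)` of (anti)holomorphic COTANGENT type at `ι` is NOT
# one-dimensional — kernel evidence for line LH1 of crux H413 (`stmt-HodgeConjecture-24833`)

Cell `hodgecm-mathlib`, half A line LH1 (closer stub `stub_S2sharp` #80), LH1-plan (g7) WORD #1 fallback (N1), hand LH1-p01 (g8).
THEOREMS ONLY (no definition, no named fact, no instance, no notation, no `sorry`); count-neutral road-board evidence,
lane `--supports stmt-HodgeConjecture-24833`.

PURPOSE.  Every ★ finite-adelic saturation brick of the cell (Kneser ★ p850584 ∕ p850664 ∕ p850717, dense orbit ★ p850540,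
★ p850740, ★ p850645 ∕ p850650) CONCLUDES `P.IsOneDimensional` ∕ `P = ofChar ψ μ`.  The theorem below makes it a kernel fact
that NONE of them can apply to the `P` of the LH1 letter (`S2FinLetter` ∕ `S2QpsiLetter`): a cotangent `P` is never a character.

THE ARGUMENT (no Lie-algebra structure theory, no central-character case split).
* §1 (any linear real group `G`, any `(𝔤, K)`-module `(ρK, ρ𝔤)`): if some `k₀ ∈ K` acts by `−1` on `𝔤/𝔨`
  (`Ad(k₀) X + X ∈ 𝔨`) and TRIVIALLY on `V` (`ρK k₀ = 1`), then `C^q(𝔤, K; V) = 0` for odd `q` — the cochain is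
  `k₀`-fixed, horizontal and multilinear, so `f(v) = f(Ad k₀ v) = f(−v) = −f(v)` — hence `H^q(𝔤, K; V) = 0`
  (★ `TrivialModuleGKCohomology` §3 is the case `ρK = 1`). [cite: BorelWallach2000, I §5.1 (1)–(4)]
* §2 (`G = U(2, β) = uFormGroup (Fin 2) β`, `K = U(2) × U(β)`): `k₀ = diag(−1, −1, 1_β) = kV(−1, 1)` acts by `−1` on
  `𝔭` (`Ad(diag(a,d)) X_B = X_{aBd⁻¹}`, ★ `upq_Ad_kV_offDiag`'s blocks), and `ρK(k₀) = 1` on EVERY `K`-module of complex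
  dimension one: `−1 = [a, b] ∈ SU(2)` (`a = diag(i, −i)`, `b = [[0,1],[−1,0]]`) is a commutator and the endomorphism
  ring of a line is commutative (Mathlib `LinearMap.existsUnique_eq_smul_id_of_finrank_eq_one`).  Hence
  `H^{odd}(𝔲(2,β), K; V) = 0` and every type space `H^n_δ` (★ `upqTypeClasses`) is `⊥` for odd `n` whenever
  `finrank ℂ V = 1`. [cite: BorelWallach2000, I §5.1; VI Thm. 4.11 (the row of the one-dimensional `J_{0,0} ⊗ χ`)]
* §3 (the LH1 frame `L ι H T hT μ`): ★ «Tok» `F0P3SLayerFoldShapes.exists_cohToken_of_isHolOrAntihol_cpt` hands an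
  IRREDUCIBLE `(𝔤, K)`-module `M` with a NON-ZERO equivariant `T₁ : P.archModuleCM ι T hT →ₗ M` and
  `upqTypeClasses σK σ𝔤 _ 1 δ ≠ ⊥`; if `P` were one-dimensional then `P.archModuleCM ι T hT ≤ P.space` has `finrank ≤ 1`,
  the `(𝔤, K)`-stable range of `T₁` is all of `M` (irreducibility), so `finrank ℂ M = 1` and §2 gives `upqTypeClasses … 1 δ = ⊥`
  — contradiction.  Corollary: `P ≠ ofChar ψ μ` for every automorphic character `ψ`.
  [cite: BorelWallach2000, VI Thm. 4.11] [cite: Rogawski1990, Prop. 15.2.1 (b); §15.3] [cite: BorelJacquet1979, §4.6]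

HONEST LABEL.  Count-neutral: no organ of LH1 is paid here (FIN `stub_S2fin`, Ξ∞ `stub_S2qpsi` are print); HC_CM is proved only
modulo the 7 printed citations (2 remaining: hLiu418 = stmt-HodgeConjecture-24832, h413 = stmt-HodgeConjecture-24833) until rung 0 closes.
-/

set_option linter.dupNamespace false

noncomputable section

open scoped Matrix MatrixGroups ComplexConjugate

namespace Summit.HodgeConjecture.HodgeConjecture.Cruxes.H413.F0P3cCotangentNotOneDimensional

open Literature.Algebra.Lie Literature.Algebra.Lie.ChevalleyEilenberg
open Literature.NumberTheory.Automorphic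
open Literature.RepresentationTheory.BorelWallach2000
open Literature.RepresentationTheory.KonnoKonno2007
open Literature.RepresentationTheory.KonnoKonno2007.RealDualPair
open Literature.RepresentationTheory.KonnoKonno2007.RealDualPair.UForm

-- Mathlib idiom (as in ★ `GKModules`, `GKCohomology`): commutator bracket on `Module.End` / matrices
attribute [local instance 100] LieRing.ofAssociativeRing

/-! ## §1 Odd cochains vanish when an element of `K` acts by `−1` on `𝔤/𝔨` and by `1` on `V` (any `(𝔤, K)`-module) -/

section Generic

variable {A : Type*} [NormedCommRing A] [NormedAlgebra ℝ A] [NormedAlgebra ℚ A] [CompleteSpace A]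
  [StarRing A] [StarModule ℝ A] {N : Type*} [Fintype N] [DecidableEq N] (G : RealMatrixGroup A N)
  {V : Type*} [AddCommGroup V] [Module ℂ V]
  (ρK : Representation ℂ G.maximalCompact V) (ρ𝔤 : G.lie →ₗ⁅ℝ⁆ Module.End ℂ V)
  (hV : ∀ (k : G.maximalCompact) (X : G.lie),
    ρK k ∘ₗ ρ𝔤 X ∘ₗ ρK k⁻¹ = ρ𝔤 (G.Ad (Subgroup.inclusion G.maximalCompact_le_carrier k) X))

/-- **Odd-degree vanishing of the `(𝔤, K)`-complex, arbitrary coefficients.**  If some `k₀ ∈ K` acts by `−1` on `𝔤/𝔨`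
(`Ad(k₀) X + X ∈ 𝔨` for all `X ∈ 𝔤`) and trivially on the `(𝔤, K)`-module `V` (`ρK k₀ v = v`), then `C^q(𝔤, K; V) = 0` for odd
`q`: a cochain `f ∈ C^q(𝔤, K; V) = Hom_K(Λ^q(𝔤/𝔨), V)` is fixed by `k₀`, which acts on `Λ^q(𝔤/𝔨)` by `(−1)^q` and on `V` by `1`.
(★ `gkComplex_triv_carrier_eq_bot_of_odd` is the case of the trivial module.) [cite: BorelWallach2000, I §5.1 (1)–(3)] -/
theorem gkComplex_carrier_eq_bot_of_odd_of_apply_eq_self (k₀ : G.maximalCompact)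
    (hk₀ : ∀ X : G.lie, G.Ad (Subgroup.inclusion G.maximalCompact_le_carrier k₀) X + X ∈ G.kInLie)
    (hfix : ∀ v : V, ρK k₀ v = v) {q : ℕ} (hq : Odd q) :
    (gkComplex G ρK ρ𝔤 hV).carrier q = ⊥ := by
  obtain ⟨r, rfl⟩ := hq
  rw [eq_bot_iff]
  intro f hf
  rw [Submodule.mem_bot]
  obtain ⟨hrel, hfix'⟩ := (mem_gkComplex_succ_iff G ρK ρ𝔤 hV (2 * r) f).1 hf
  -- `k₀⁻¹` also acts trivially on `V`
  have hfixinv : ∀ w : V, ρK k₀⁻¹ w = w := fun w => by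
    conv_lhs => rw [← hfix w]
    rw [← Module.End.mul_apply, ← map_mul, inv_mul_cancel, map_one, Module.End.one_apply]
  ext v
  -- (1) `k₀`-fixedness: `f (Ad k₀ ∘ v) = f v` (the value is fixed by `ρK k₀⁻¹ = 1`)
  have h1 : f (fun i => G.Ad (Subgroup.inclusion G.maximalCompact_le_carrier k₀) (v i)) = f v := by
    have e := congrArg (fun g : Cochain ℝ G.lie (GKCarrier G ρ𝔤) (2 * r + 1) => g v) (hfix' k₀⁻¹)
    simp only [ChevalleyEilenberg.PairAction.act_apply, inv_inv] at e
    rw [← e]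
    exact (hfixinv _).symm
  -- (2) horizontality: `f (Ad k₀ ∘ v) = f (-v)` since `Ad k₀ (v i) - (-v i) ∈ 𝔨`
  have h2 : f (fun i => G.Ad (Subgroup.inclusion G.maximalCompact_le_carrier k₀) (v i)) = f (fun i => -v i) :=
    cochain_apply_eq_of_forall_sub_mem G.kInLie (fun x hx => (hrel x hx).2) _ _
      (fun i => by simpa [sub_neg_eq_add] using hk₀ (v i))
  -- (3) multilinearity: `f (-v) = (-1)^{2r+1} f v = - f v`
  have h3 : f (fun i => -v i) = -f v := by
    have e := (f : MultilinearMap ℝ (fun _ : Fin (2 * r + 1) => G.lie) (GKCarrier G ρ𝔤)).map_smul_univ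
      (fun _ => (-1 : ℝ)) v
    simp only [AlternatingMap.coe_multilinearMap, neg_one_smul, Finset.prod_const, Finset.card_univ,
      Fintype.card_fin] at e
    rw [e, pow_succ, pow_mul, neg_one_sq, one_pow, one_mul, neg_one_smul]
  have h4 : f v = -f v := by rw [← h3, ← h2, h1]
  have h5 : (2 : ℝ) • f v = 0 := by
    rw [two_smul]
    nth_rewrite 2 [h4]
    exact add_neg_cancel _
  rw [AlternatingMap.zero_apply]
  exact (smul_eq_zero.1 h5).resolve_left two_ne_zero

/-- **`H^q(𝔤, K; V) = 0` for odd `q`** as soon as some `k₀ ∈ K` acts by `−1` on `𝔤/𝔨` and by `1` on `V`.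
[cite: BorelWallach2000, I §5.1 (1)–(4)] -/
theorem subsingleton_gkCohomology_of_odd_of_apply_eq_self (k₀ : G.maximalCompact)
    (hk₀ : ∀ X : G.lie, G.Ad (Subgroup.inclusion G.maximalCompact_le_carrier k₀) X + X ∈ G.kInLie)
    (hfix : ∀ v : V, ρK k₀ v = v) {q : ℕ} (hq : Odd q) :
    Subsingleton (gkCohomology G ρK ρ𝔤 hV q) := by
  have h := gkComplex_carrier_eq_bot_of_odd_of_apply_eq_self G ρK ρ𝔤 hV k₀ hk₀ hfix hq
  have hz : ∀ z : (gkComplex G ρK ρ𝔤 hV).cocycles q, z = 0 := fun z => by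
    have hz' := (((gkComplex G ρK ρ𝔤 hV).mem_cocycles_iff q _).1 z.2).1
    rw [h, Submodule.mem_bot] at hz'
    exact Subtype.ext hz'
  refine ⟨fun a b => ?_⟩
  obtain ⟨z, rfl⟩ := (gkComplex G ρK ρ𝔤 hV).toCohomology_surjective q a
  obtain ⟨z', rfl⟩ := (gkComplex G ρK ρ𝔤 hV).toCohomology_surjective q b
  rw [hz z, hz z']

end Generic

/-! ## §2 `G = U(2, β)`: `k₀ = diag(−1, −1, 1_β)` acts by `−1` on `𝔭` and by `1` on every one-dimensional `K`-module -/

section Upq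

variable {α β : Type*} [Fintype α] [DecidableEq α] [Fintype β] [DecidableEq β]

/-- **`Ad(diag(−1_α, 1_β))` acts by `−1` on `𝔲(α,β)/𝔨`**: `Ad(k₀) X + X` is block diagonal for `k₀ = kV(−1, 1) = diag(−1_α, 1_β) ∈ K`
(`k₀ = −D` for the form matrix `D = diag(1_α, −1_β)` of ★ `upq_Ad_signForm_add_mem_kInLie`; `Ad(−D) = Ad(D)` is the Cartan involution).
[cite: BorelWallach2000, II §1.1 (3)] -/
theorem upq_Ad_kV_negOne_one_add_mem_kInLie (X : (uFormGroup α β).lie) :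
    (uFormGroup α β).Ad (Subgroup.inclusion (uFormGroup α β).maximalCompact_le_carrier
        ⟨_, upq_kV_mem_maximalCompact (α := α) (β := β) (-1) 1⟩) X + X ∈ (uFormGroup α β).kInLie := by
  rw [upq_mem_kInLie_iff_blocks]
  have hg : (((Subgroup.inclusion (uFormGroup α β).maximalCompact_le_carrier
      ⟨_, upq_kV_mem_maximalCompact (α := α) (β := β) (-1) 1⟩ : (uFormGroup α β).carrier) : GL (α ⊕ β) ℂ) :
        Matrix (α ⊕ β) (α ⊕ β) ℂ) = Matrix.fromBlocks (-1) 0 0 1 := by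
    change (((kV α β ((-1 : Matrix.unitaryGroup α ℂ), (1 : Matrix.unitaryGroup β ℂ)) : UForm α β) : GL (α ⊕ β) ℂ) :
      Matrix (α ⊕ β) (α ⊕ β) ℂ) = _
    rw [coe_kV, Unitary.coe_neg, OneMemClass.coe_one, OneMemClass.coe_one]
  have hginv : ((((Subgroup.inclusion (uFormGroup α β).maximalCompact_le_carrier
      ⟨_, upq_kV_mem_maximalCompact (α := α) (β := β) (-1) 1⟩ : (uFormGroup α β).carrier) : GL (α ⊕ β) ℂ)⁻¹ : GL (α ⊕ β) ℂ) :
        Matrix (α ⊕ β) (α ⊕ β) ℂ) = Matrix.fromBlocks (-1) 0 0 1 := by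
    rw [Matrix.coe_units_inv, hg]
    refine Matrix.inv_eq_left_inv ?_
    rw [Matrix.fromBlocks_multiply, ← Matrix.fromBlocks_one]
    simp
  rw [AddMemClass.coe_add, RealMatrixGroup.Ad_apply_coe, hg, hginv]
  set M : Matrix (α ⊕ β) (α ⊕ β) ℂ := (X : Matrix (α ⊕ β) (α ⊕ β) ℂ) with hM
  conv_lhs => rw [← Matrix.fromBlocks_toBlocks M, Matrix.mul_assoc, Matrix.fromBlocks_multiply,
    Matrix.fromBlocks_multiply, Matrix.fromBlocks_add]
  simp

/-- The endomorphism ring of a line is commutative: any two `ℂ`-linear endomorphisms of `V` with `finrank ℂ V = 1` commute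
(each is a scalar, Mathlib `LinearMap.existsUnique_eq_smul_id_of_finrank_eq_one`). [folklore] -/
theorem mul_comm_of_finrank_eq_one {V : Type*} [AddCommGroup V] [Module ℂ V] (hV1 : Module.finrank ℂ V = 1)
    (f g : Module.End ℂ V) : f * g = g * f := by
  obtain ⟨c, hc, -⟩ := LinearMap.existsUnique_eq_smul_id_of_finrank_eq_one hV1 f
  obtain ⟨d, hd, -⟩ := LinearMap.existsUnique_eq_smul_id_of_finrank_eq_one hV1 g
  rw [hc, hd, smul_mul_smul_comm, smul_mul_smul_comm, mul_comm c d]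

/-- **`−1 ∈ U(2)` is a commutator**: `a b a⁻¹ b⁻¹ = −1` for `a = diag(i, −i)`, `b = [[0, 1], [−1, 0]]` (both in `SU(2)`). [folklore] -/
theorem exists_commutator_eq_neg_one_unitaryGroup_fin_two :
    ∃ a b : Matrix.unitaryGroup (Fin 2) ℂ, a * b * a⁻¹ * b⁻¹ = -1 := by
  have ha : !![Complex.I, 0; 0, -Complex.I] ∈ Matrix.unitaryGroup (Fin 2) ℂ := by
    rw [Matrix.mem_unitaryGroup_iff]
    ext i j
    fin_cases i <;> fin_cases j <;> simp [Matrix.mul_apply, Matrix.star_eq_conjTranspose]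
  have hb : !![(0 : ℂ), 1; -1, 0] ∈ Matrix.unitaryGroup (Fin 2) ℂ := by
    rw [Matrix.mem_unitaryGroup_iff]
    ext i j
    fin_cases i <;> fin_cases j <;> simp [Matrix.mul_apply, Matrix.star_eq_conjTranspose]
  refine ⟨⟨_, ha⟩, ⟨_, hb⟩, ?_⟩
  have hab : (⟨_, ha⟩ * ⟨_, hb⟩ : Matrix.unitaryGroup (Fin 2) ℂ) = -1 * (⟨_, hb⟩ * ⟨_, ha⟩) := by
    apply Subtype.ext
    rw [Submonoid.coe_mul, Submonoid.coe_mul, Unitary.coe_neg, OneMemClass.coe_one, Submonoid.coe_mul]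
    ext i j
    fin_cases i <;> fin_cases j <;> simp [Matrix.mul_apply]
  rw [hab, mul_assoc (-1) (⟨_, hb⟩ * ⟨_, ha⟩ : Matrix.unitaryGroup (Fin 2) ℂ), mul_inv_cancel_right, mul_assoc,
    mul_inv_cancel, mul_one]

/-- **`diag(−1, −1, 1_β)` acts trivially on every one-dimensional `K`-module of `U(2, β)`** (`K = U(2) × U(β)`): `ρK(kV(−1, 1)) = 1` when
`finrank ℂ V = 1`, since `kV(−1, 1) = [kV(a,1), kV(b,1)]` is a commutator in `K` and the endomorphisms of a line commute. [folklore] -/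
theorem upq_apply_kV_negOne_one_eq_self_of_finrank_eq_one {V : Type*} [AddCommGroup V] [Module ℂ V]
    (ρK : Representation ℂ (uFormGroup (Fin 2) β).maximalCompact V) (hV1 : Module.finrank ℂ V = 1) (v : V) :
    ρK ⟨_, upq_kV_mem_maximalCompact (α := Fin 2) (β := β) (-1) 1⟩ v = v := by
  obtain ⟨a, b, hab⟩ := exists_commutator_eq_neg_one_unitaryGroup_fin_two
  -- `U(2) → K`, `a ↦ kV(a, 1)` as a group homomorphism
  let φ : Matrix.unitaryGroup (Fin 2) ℂ →* (uFormGroup (Fin 2) β).maximalCompact :=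
    MonoidHom.codRestrict ((unitaryGroupOfForm (starRingEnd ℂ) (signForm (Fin 2) β)).subtype.comp
      ((kV (Fin 2) β).comp (MonoidHom.inl _ _))) (uFormGroup (Fin 2) β).maximalCompact
      (fun x => upq_kV_mem_maximalCompact (α := Fin 2) (β := β) x 1)
  have hk₀ : (⟨_, upq_kV_mem_maximalCompact (α := Fin 2) (β := β) (-1) 1⟩ : (uFormGroup (Fin 2) β).maximalCompact) = φ (-1) := rfl
  rw [hk₀, ← hab, map_mul, map_mul, map_mul, map_inv, map_inv, map_mul, map_mul, map_mul,
    mul_assoc (ρK (φ a)), mul_comm_of_finrank_eq_one hV1 (ρK (φ b)) (ρK (φ a)⁻¹), ← mul_assoc, ← map_mul,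
    mul_inv_cancel, map_one, one_mul, ← map_mul, mul_inv_cancel, map_one, Module.End.one_apply]

variable {V : Type*} [AddCommGroup V] [Module ℂ V]
  (ρK : Representation ℂ (uFormGroup (Fin 2) β).maximalCompact V) (ρ𝔤 : (uFormGroup (Fin 2) β).lie →ₗ⁅ℝ⁆ Module.End ℂ V)
  (hV : ∀ (k : (uFormGroup (Fin 2) β).maximalCompact) (X : (uFormGroup (Fin 2) β).lie),
    ρK k ∘ₗ ρ𝔤 X ∘ₗ ρK k⁻¹ =
      ρ𝔤 ((uFormGroup (Fin 2) β).Ad (Subgroup.inclusion (uFormGroup (Fin 2) β).maximalCompact_le_carrier k) X))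

/-- **`C^q(𝔲(2,β), K; V) = 0` for odd `q` and every `(𝔤, K)`-module `V` of complex dimension one.** [cite: BorelWallach2000, I §5.1 (1)–(3)] -/
theorem upq_gkComplex_carrier_eq_bot_of_odd_of_finrank_eq_one (hV1 : Module.finrank ℂ V = 1) {q : ℕ} (hq : Odd q) :
    (gkComplex (uFormGroup (Fin 2) β) ρK ρ𝔤 hV).carrier q = ⊥ :=
  gkComplex_carrier_eq_bot_of_odd_of_apply_eq_self (uFormGroup (Fin 2) β) ρK ρ𝔤 hV
    ⟨_, upq_kV_mem_maximalCompact (α := Fin 2) (β := β) (-1) 1⟩ upq_Ad_kV_negOne_one_add_mem_kInLie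
    (upq_apply_kV_negOne_one_eq_self_of_finrank_eq_one ρK hV1) hq

/-- **`H^q(𝔲(2,β), K; V) = 0` for odd `q` and every `(𝔤, K)`-module `V` of complex dimension one** — in particular `H¹ = 0` for every
one-dimensional `(𝔤, K)`-module of `U(2,1)` (the characters `χ ∘ det`: the row of `J_{0,0}`, twisted, has no odd entries).
[cite: BorelWallach2000, I §5.1 (1)–(4); VI Thm. 4.11] -/
theorem upq_subsingleton_gkCohomology_of_odd_of_finrank_eq_one (hV1 : Module.finrank ℂ V = 1) {q : ℕ} (hq : Odd q) :
    Subsingleton (gkCohomology (uFormGroup (Fin 2) β) ρK ρ𝔤 hV q) :=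
  subsingleton_gkCohomology_of_odd_of_apply_eq_self (uFormGroup (Fin 2) β) ρK ρ𝔤 hV
    ⟨_, upq_kV_mem_maximalCompact (α := Fin 2) (β := β) (-1) 1⟩ upq_Ad_kV_negOne_one_add_mem_kInLie
    (upq_apply_kV_negOne_one_eq_self_of_finrank_eq_one ρK hV1) hq

/-- **Every type space `H^n_δ(𝔲(2,β), K; V)` is `⊥` for odd `n` when `finrank ℂ V = 1`** — the form consumed below at `n = 1`, `δ = ±1`.
[cite: BorelWallach2000, I §5.1; II §4.2] -/
theorem upqTypeClasses_eq_bot_of_odd_of_finrank_eq_one (hV1 : Module.finrank ℂ V = 1) {n : ℕ} (hn : Odd n) (δ : ℤ) :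
    upqTypeClasses ρK ρ𝔤 hV n δ = ⊥ := by
  haveI := upq_subsingleton_gkCohomology_of_odd_of_finrank_eq_one ρK ρ𝔤 hV hV1 hn
  exact Subsingleton.elim _ _

end Upq

/-! ## §3 The LH1 frame: a cotangent `P` is not one-dimensional -/

section Datum

open NumberField NumberField.InfinitePlace MeasureTheory
open scoped ComplexOrder
open Literature.NumberTheory.Automorphic.UnitaryGroup Literature.NumberTheory.Automorphic.UnitaryGroup.CotangentForms
open Summit.HodgeConjecture.HodgeConjecture.Cruxes.H413.F0P3SLayerFoldShapes

variable (L : Type) [Field L] [NumberField L] [IsCMField L] (ι : L →+* ℂ) (H : Matrix (Fin 3) (Fin 3) L) (T : GL (Fin 3) ℂ)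
  (hT : (T : Matrix (Fin 3) (Fin 3) ℂ)ᴴ * H.map ι * (T : Matrix (Fin 3) (Fin 3) ℂ) = Literature.Geometry.ComplexHyperbolic.BallModel.J)
  (μ : Measure (adelicGroupData (↥(maximalRealSubfield L)) L (IsCMField.complexConj L) 3 H).automorphicQuotient)
  [(adelicGroupData (↥(maximalRealSubfield L)) L (IsCMField.complexConj L) 3 H).IsAutomorphicMeasure μ]

/-- **(N1) «NOT-A-CHARACTER».**  In the LH1 letter frame (`L` CM with `[L⁺:ℚ] ≥ 2`, `H` of signature `(2,1)` at `ι` with frame `T`, definite at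
the other complex places, `μ` automorphic), a discrete automorphic representation `P` of `U(H)` of holomorphic or antiholomorphic COTANGENT type
at `ι` is NOT one-dimensional.  Proof: ★ «Tok» gives an irreducible `(𝔤, K)`-module `M` of `U(2,1)` with a non-zero equivariant
`T₁ : P.archModuleCM ι T hT →ₗ M` and a non-zero type space `H¹_δ(M)`; were `P` one-dimensional, `P.archModuleCM ι T hT ≤ P.space` would have
`finrank ≤ 1`, the `(𝔤, K)`-stable range of `T₁` would be all of `M`, so `finrank ℂ M = 1` and §2 gives `H¹_δ(M) = ⊥`.
[cite: BorelWallach2000, VI Thm. 4.11; I §5.1] [cite: Rogawski1990, Prop. 15.2.1 (b); §15.3] [cite: BorelJacquet1979, §4.6] -/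
theorem not_isOneDimensional_of_isHolOrAntiholCotangentAt
    (hdef : ∀ τ' : L →+* ℂ, InfinitePlace.mk τ' ≠ InfinitePlace.mk ι → (H.map τ').PosDef) (h2 : 2 ≤ Module.finrank ℚ ↥(maximalRealSubfield L))
    (P : DiscreteAutomorphicRep (adelicGroupData (↥(maximalRealSubfield L)) L (IsCMField.complexConj L) 3 H) μ)
    (hP : P.IsHolCotangentAt (cmArchSection L ι H T hT) (cmCompactFactor L ι H T hT) ∨
      P.IsAntiholCotangentAt (cmArchSection L ι H T hT) (cmCompactFactor L ι H T hT)) :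
    ¬ P.IsOneDimensional := by
  intro h1
  obtain ⟨M, _, _, σK, σ𝔤, hM, δ, -, hirr, ⟨T₁, hT₁K, hT₁𝔤, hT₁⟩, hne⟩ :=
    exists_cohToken_of_isHolOrAntihol_cpt L ι H T hT μ hdef h2 P hP
  have hfin : Module.finrank ℂ ↥P.space.toSubmodule = 1 := h1
  haveI : Module.Finite ℂ ↥P.space.toSubmodule := Module.finite_of_finrank_eq_succ hfin
  -- the range of the token map is a non-zero `(𝔤, K)`-submodule of the irreducible `M`, hence all of `M`
  have hsub : IsGKSubmodule σK σ𝔤 (LinearMap.range T₁) := by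
    refine ⟨fun k w hw => ?_, fun X w hw => ?_⟩
    · obtain ⟨u, rfl⟩ := LinearMap.mem_range.1 hw
      exact LinearMap.mem_range.2 ⟨P.archRepKCM ι T hT k u, hT₁K k u⟩
    · obtain ⟨u, rfl⟩ := LinearMap.mem_range.1 hw
      exact LinearMap.mem_range.2 ⟨P.archRepLieCM ι T hT X u, hT₁𝔤 X u⟩
  have hrange : LinearMap.range T₁ = ⊤ := by
    rcases hirr.eq_bot_or_eq_top hsub with h | h
    · exact absurd (LinearMap.range_eq_bot.1 h) hT₁
    · exact h
  have hsurj : Function.Surjective T₁ := LinearMap.range_eq_top.1 hrange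
  haveI : Module.Finite ℂ M := Module.Finite.of_surjective T₁ hsurj
  haveI : Nontrivial M := hirr.nontrivial
  have hM1 : Module.finrank ℂ M = 1 := by
    apply le_antisymm
    · calc Module.finrank ℂ M = Module.finrank ℂ (⊤ : Submodule ℂ M) := (finrank_top ℂ M).symm
        _ = Module.finrank ℂ (LinearMap.range T₁) := by rw [hrange]
        _ ≤ Module.finrank ℂ ↥(P.archModuleCM ι T hT) := LinearMap.finrank_range_le T₁
        _ ≤ Module.finrank ℂ ↥P.space.toSubmodule := Submodule.finrank_le _
        _ = 1 := hfin
    · exact Module.finrank_pos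
  exact hne (upqTypeClasses_eq_bot_of_odd_of_finrank_eq_one σK σ𝔤 hM.ad_compat hM1 odd_one δ)

/-- **Corollary: a cotangent `P` is not the line of an automorphic character** — `P ≠ ofChar ψ μ` for every automorphic character `ψ` of `U(H)`
(★ `isOneDimensional_ofChar`); so no ★ saturation brick concluding `P = ofChar ψ μ` ∕ `P.IsOneDimensional` applies to the `P` of the LH1 letters.
[cite: BorelJacquet1979, §4.6] [cite: BorelWallach2000, VI Thm. 4.11] -/
theorem ne_ofChar_of_isHolOrAntiholCotangentAt
    (hdef : ∀ τ' : L →+* ℂ, InfinitePlace.mk τ' ≠ InfinitePlace.mk ι → (H.map τ').PosDef) (h2 : 2 ≤ Module.finrank ℚ ↥(maximalRealSubfield L))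
    (P : DiscreteAutomorphicRep (adelicGroupData (↥(maximalRealSubfield L)) L (IsCMField.complexConj L) 3 H) μ)
    (hP : P.IsHolCotangentAt (cmArchSection L ι H T hT) (cmCompactFactor L ι H T hT) ∨
      P.IsAntiholCotangentAt (cmArchSection L ι H T hT) (cmCompactFactor L ι H T hT))
    (ψ : (adelicGroupData (↥(maximalRealSubfield L)) L (IsCMField.complexConj L) 3 H).AutomorphicCharacter) :
    P ≠ DiscreteAutomorphicRep.ofChar ψ μ := by
  intro h
  refine not_isOneDimensional_of_isHolOrAntiholCotangentAt L ι H T hT μ hdef h2 P hP ?_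
  rw [h]
  exact DiscreteAutomorphicRep.isOneDimensional_ofChar ψ μ

end Datum

end Summit.HodgeConjecture.HodgeConjecture.Cruxes.H413.F0P3cCotangentNotOneDimensional

end
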